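import Summits.CriticalPhenomena.PercolationContinuityZ3.Theorems.PercNearOneGluingNoHeavyLowerTailKNGoodTwoStarsLeTwo
import Summits.CriticalPhenomena.PercolationContinuityZ3.Theorems.PercNearOneGluingNoHeavyLowerTailKNGoodConjOne
import HarnessLib

/-!
# Kozma–Nitzan's Conjecture 1 (weak max-form) for an observer with two pendant star children having at most two ports each, any core
# (`NoHeavyLowerTail` cell, stmt-CriticalPhenomena-4575; prover `prim-hp-2`, deletion–contraction line, gen 8)

Support file (`--supports stmt-CriticalPhenomena-4575`).  No definitions, no named facts, no sorries.
Corollary of the umbrella `KNGoodTwoTwo.knGood_twoPendantStars_portsLeTwo` through `KNGoodConjOne.conj1_weak_of_knGood`: for the observer class of that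
theorem and every `M` with `μ(a ↮ b) ≤ M` for all `a ∈ A`, `μ(o ↔ A) − μ(o ↔ b) ≤ μ(o ↔ A)·M`, i.e. `μ(o ↔ b) ≥ μ(o ↔ A)(1 − max_a μ(a ↮ b))`.
-/

namespace Summit.CriticalPhenomena.PercolationContinuityZ3.Theorems

open MeasureTheory Set ProbabilityTheory Literature.Probability.LatticeModels Literature.Probability.Percolation

noncomputable section
open Classical
namespace KNGoodTwoTwo
open KNGoodConjOne

variable {n : ℕ}

/-- **Conjecture 1 (weak max-form) for `o` + relay hairs + two pendant stars with at most two ports each, any core.**  See the module docstring.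
[cite: KozmaNitzan2024, Conjecture 1 and (3) (p. 3), §3.2 (p. 12), Thm. 4–5 (pp. 12–14)] -/
theorem conj1_weak_twoPendantStars_portsLeTwo (w : Sym2 (Fin n) → unitInterval) (A : Finset (Fin n)) (hA : A.Nonempty)
    (o x y b : Fin n) (Px Py : Finset (Fin n)) (ho : o ∉ A) (hx : x ∉ A) (hy : y ∉ A) (hxo : x ≠ o) (hyo : y ≠ o) (hxy : x ≠ y)
    (hbo : b ≠ o) (hbx : b ≠ x) (hby : b ≠ y) (hPx : Px ⊆ A) (hPy : Py ⊆ A) (hcx : Px.card ≤ 2) (hcy : Py.card ≤ 2)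
    (hoN : ∀ v : Fin n, v ≠ o → v ∉ A → v ≠ x → v ≠ y → w s(o, v) = 0)
    (hxN : ∀ z : Fin n, z ∉ Px → z ≠ o → w s(x, z) = 0) (hyN : ∀ z : Fin n, z ∉ Py → z ≠ o → w s(y, z) = 0)
    (hxh : ∀ p ∈ Px, 0 < (w s(x, p) : ℝ) ∧ (w s(x, p) : ℝ) < 1) (hyh : ∀ q ∈ Py, 0 < (w s(y, q) : ℝ) ∧ (w s(y, q) : ℝ) < 1)
    (M : ℝ) (hM : ∀ a ∈ A, (prodBernoulli w).real (openConn a b : Set (BondConfig (Fin n)))ᶜ ≤ M) :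
    (prodBernoulli w).real (⋃ a ∈ A, (openConn o a : Set (BondConfig (Fin n)))) -
        (prodBernoulli w).real (openConn o b : Set (BondConfig (Fin n))) ≤
      (prodBernoulli w).real (⋃ a ∈ A, (openConn o a : Set (BondConfig (Fin n)))) * M :=
  conj1_weak_of_knGood w A hA o b
    (knGood_twoPendantStars_portsLeTwo w A hA o x y b Px Py ho hx hy hxo hyo hxy hbo hbx hby hPx hPy hcx hcy hoN hxN hyN hxh hyh) M hM

end KNGoodTwoTwo

end

end Summit.CriticalPhenomena.PercolationContinuityZ3.Theorems
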